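import Mathlib
import Literature.NumberTheory.LFunctions.Zhang2022.TypedAppendixB
import Literature.NumberTheory.LFunctions.Zhang2022.GaussKernelContour
import Literature.NumberTheory.LFunctions.ZetaClassicalRegionBounds
import Literature.NumberTheory.LFunctions.ZetaLogDerivDisc
import HarnessLib

/-!
# Zhang (2022), Appendix B, proof of (B.3): the contour shift behind `Z22:§B.u015` (second line)

Topic `Literature/NumberTheory/LFunctions/Zhang2022` (Landau–Siegel audit tree; verdict-neutral).
Y. Zhang, *Discrete mean estimates and the Landau–Siegel zero*, arXiv:2211.02515v1 (2022)
[Zhang2022LandauSiegel] — **an unrefereed manuscript under adjudication; nothing here asserts or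
denies its Theorems 1–2.** Appendix B p. 108 (tex L5330–L5333, DAG `Z22:§B.u015`): the inner line
integral of the double integral `doubleB15`,
`(1/2πi)∫_{(1)} xˢ ζ(1+s)/ζ(1+s−β_j) ω₁(s−β₆) ds/(s−β₆)` (`x = P^z/l₁` resp. `P^{0.5}/l₁`),
"in a way similar to the proof of [Lemma 8.4]" equals the residues at `s = 0` (pole of `ζ(1+s)`) and
`s = β₆` (pole of the kernel) up to an error which is here made explicit and shown to be `O(α)`.

PROOF (`lineIntegral_sub_residues_le`): the integrand is `Φ·K` with the tree's Gaussian Perron kernel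
`K(s) = x^{s−β₆}ω₁(s−β₆)/(s−β₆)` (`Zhang2022/GaussKernelContour.lean`, `β = −β₆`, `Y = x`) and
`Φ(s) = x^{β₆}ζ(1+s)(s−β_j)/ζ₁(1+s−β_j)`, where `ζ₁(w) = (w−1)ζ(w)` is Mathlib's ENTIRE `riemannZeta₁`
(so `Φ` is holomorphic at `s = β_j`, where `1/ζ(1+s−β_j)` has only a removable singularity); Landau's
rectangle `[−η, 1] × [−H, H]` with `H = Λ = 𝓛³⁰`, `η = 2c̄/log(H+5)` inside the classical zero-free
region (`Literature.NumberTheory.LFunctions.ZetaClassicalRegion.exists_zeroFreeRegion_bounds`: `ζ ≠ 0`,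
`|ζ(s) − 1/(s−1)|, |1/ζ(s)| ≤ C log(|t|+3)` for `σ ≥ 1 − 4c̄/log(|t|+3)`); the contour bookkeeping is
`GaussKernelContour.norm_lineIntegral_sub_sum_limUnder_le` (residues as punctured limits); the two
residues are `R₀ = (β_j/β₆)·ω₁(−β₆)/ζ₁(1−β_j)` and `R_β(x) = x^{β₆}ζ(1+β₆)(β₆−β_j)/ζ₁(1+β₆−β_j)`; and for
`e^{0.4𝓛⁹} ≤ x ≤ e^{0.504𝓛⁹}` the three error pieces (Gaussian tails beyond height `H`, the left line
with the saving `x^{−η}`, the horizontal segments) are each `≤ const·𝓛⁻⁹`, i.e. `O(α)`.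
No claim about Lemma 15.1, Theorems 1–2 of the source or about Landau–Siegel zeros is made.

## References

* Y. Zhang, arXiv:2211.02515v1 (2022), App. B p. 108 (proof of (B.3)); §8 proof of Lemma 8.2 p. 44
  (the contour); §4 (4.1). [cite: Zhang2022LandauSiegel, App. B p.108]
* H. L. Montgomery, R. C. Vaughan, *Multiplicative Number Theory I*, CUP 2007, §6.2 (Landau's
  contour), Thm 6.7 (`1/ζ ≪ log t`). [cite: MontgomeryVaughan2007, §6.2]
-/

noncomputable section

open Complex Real MeasureTheory Set Filter Topology

namespace Literature.NumberTheory.LFunctions.Zhang2022.AppendixBVarrho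

open Literature.NumberTheory.LFunctions.Zhang2022 Skeleton Typed.AppendixB GaussWeight

/-! ## `ζ`, `ζ₁` bookkeeping -/

/-- `1/ζ(w) = (w − 1)/ζ₁(w)` for `w ≠ 1` (`ζ(w) = (w−1)⁻¹ζ₁(w)`, Mathlib `riemannZeta_eq_inv_sub_mul`;
`ζ₁` is the entire function `(w−1)ζ(w)`, the simple pole of `ζ` at `1` with residue `1`).
[cite: Titchmarsh1986, §2.1 eq. (2.1.16)] -/
theorem inv_riemannZeta_eq_div_zeta₁ {w : ℂ} (hw : w ≠ 1) :
    (riemannZeta w)⁻¹ = (w - 1) / riemannZeta₁ w := by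
  rw [riemannZeta_eq_inv_sub_mul hw, mul_inv, inv_inv, div_eq_mul_inv]

/-- `ζ₁(w) ≠ 0` when `w = 1` or `ζ(w) ≠ 0` (`ζ₁(1) = 1`, the residue of `ζ` at `1`).
[cite: Titchmarsh1986, §2.1 eq. (2.1.16)] -/
theorem riemannZeta₁_ne_zero_of {w : ℂ} (h : w ≠ 1 → riemannZeta w ≠ 0) : riemannZeta₁ w ≠ 0 := by
  by_cases hw : w = 1
  · rw [hw, riemannZeta₁_one]; exact one_ne_zero
  · rw [Literature.NumberTheory.LFunctions.riemannZeta₁_eq_mul hw]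
    exact mul_ne_zero (sub_ne_zero.mpr hw) (h hw)

/-- On `Re w = 2`: `‖ζ(w)‖ ≤ 2` and `‖ζ(w)⁻¹‖ ≤ 2` (the tree's `ZetaClassicalRegion` bounds `σ/(σ−1)`).
[cite: Titchmarsh1986, §1.1 eq. (1.1.4)] -/
theorem norm_zeta_and_inv_le_two {w : ℂ} (hw : w.re = 2) :
    ‖riemannZeta w‖ ≤ 2 ∧ ‖(riemannZeta w)⁻¹‖ ≤ 2 := by
  have h1 : 1 < w.re := by rw [hw]; norm_num
  have h2 : w.re / (w.re - 1) = 2 := by rw [hw]; norm_num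
  exact ⟨(ZetaClassicalRegion.norm_riemannZeta_le_of_one_lt_re h1).trans h2.le,
    (ZetaClassicalRegion.norm_inv_riemannZeta_le_of_one_lt_re h1).trans h2.le⟩

/-! ## Elementary inequalities at a large modulus -/

/-- `vᵏe^{−av} ≤ k!/aᵏ` (`a > 0`, `v ≥ 0`). [folklore] -/
private theorem pow_mul_exp_neg_le' {a v : ℝ} (ha : 0 < a) (hv : 0 ≤ v) (k : ℕ) :
    v ^ k * Real.exp (-(a * v)) ≤ (k.factorial : ℝ) / a ^ k := by
  have h := Real.pow_div_factorial_le_exp (x := a * v) (by positivity) k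
  have hf : (0 : ℝ) < k.factorial := by positivity
  have hak : 0 < a ^ k := pow_pos ha k
  rw [div_le_iff₀ hf] at h
  rw [le_div_iff₀ hak, Real.exp_neg]
  have hexp : 0 < Real.exp (a * v) := Real.exp_pos _
  rw [mul_pow] at h
  calc v ^ k * (Real.exp (a * v))⁻¹ * a ^ k = (a ^ k * v ^ k) / Real.exp (a * v) := by
        rw [div_eq_mul_inv]; ring
    _ ≤ k.factorial := by rw [div_le_iff₀ hexp]; linarith

/-- `e^{−u} ≤ 1/u` for `u > 0`. [folklore] -/
private theorem exp_neg_le_inv {u : ℝ} (hu : 0 < u) : Real.exp (-u) ≤ 1 / u := by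
  have h := pow_mul_exp_neg_le' one_pos hu.le 1
  simp only [pow_one, one_mul, Nat.factorial_one, Nat.cast_one, div_one] at h
  rw [le_div_iff₀ hu]; linarith

/-- `log(L³⁰ + 5) ≤ 31·L` for `L ≥ 2` (`log y ≤ y − 1`). [folklore] -/
private theorem log_pow_thirty_add_five_le {L : ℝ} (hL : 2 ≤ L) : Real.log (L ^ 30 + 5) ≤ 31 * L := by
  have hL0 : 0 < L := by linarith
  have hL30 : (2 : ℝ) ^ 30 ≤ L ^ 30 := pow_le_pow_left₀ (by norm_num) hL 30
  have h1 : L ^ 30 + 5 ≤ 2 * L ^ 30 := by nlinarith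
  have h2 : Real.log (L ^ 30 + 5) ≤ Real.log (2 * L ^ 30) :=
    Real.log_le_log (by positivity) h1
  have h3 : Real.log (2 * L ^ 30) = Real.log 2 + 30 * Real.log L := by
    rw [Real.log_mul (by norm_num) (by positivity), Real.log_pow]; norm_num
  have h4 : Real.log L ≤ L - 1 := by
    have := Real.log_le_sub_one_of_pos hL0; linarith
  have h5 : Real.log 2 ≤ 1 := by
    have := Real.log_two_lt_d9; linarith
  linarith

/-! ## The three error pieces are `O(𝓛⁻⁹)` (pure real-variable bookkeeping) -/

section Numeric

variable {L Λ cb C x η ℓH : ℝ}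

/-- Term A (the two Gaussian tails beyond height `H = Λ`): `≤ 16πe·4096/𝓛⁹`. [folklore] -/
private theorem termA_le (hL2 : 2 ≤ L) (hΛdef : Λ = L ^ 30) {α₀ : ℝ} (hα0 : 0 < α₀) (hα1 : α₀ < 1 / 100)
    (hx2 : x ≤ Real.exp (0.504 * L ^ 9)) :
    2 * (4 * (x ^ (1 : ℝ) * Real.exp ((1 : ℝ) ^ 2 / (4 * Λ)) / 1) *
        (gauss (4 * Λ)⁻¹ (Λ - 3 / 2 * α₀) * (Real.sqrt (4 * π * Λ) / 2))) ≤
      (16 * π * Real.exp 1 * 4096) / L ^ 9 := by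
  have hL0 : 0 < L := by linarith
  have hL1 : 1 ≤ L := by linarith
  have hΛ1 : (2 : ℝ) ^ 30 ≤ Λ := by rw [hΛdef]; exact pow_le_pow_left₀ (by norm_num) hL2 30
  have hΛ0 : 0 < Λ := by linarith [show (0:ℝ) < 2 ^ 30 by norm_num]
  have hΛ9 : L ^ 9 ≤ Λ := by rw [hΛdef]; exact pow_le_pow_right₀ hL1 (by norm_num)
  -- the Gaussian factor
  have hHb : Λ / 2 ≤ Λ - 3 / 2 * α₀ := by nlinarith
  have hg : gauss (4 * Λ)⁻¹ (Λ - 3 / 2 * α₀) ≤ Real.exp (-(Λ / 16)) := by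
    rw [gauss]
    apply Real.exp_le_exp.mpr
    have h1 : (Λ / 2) ^ 2 ≤ (Λ - 3 / 2 * α₀) ^ 2 := pow_le_pow_left₀ (by positivity) hHb 2
    have h2 : (4 * Λ)⁻¹ * (Λ / 2) ^ 2 = Λ / 16 := by field_simp; ring
    have h3 : (4 * Λ)⁻¹ * (Λ / 2) ^ 2 ≤ (4 * Λ)⁻¹ * (Λ - 3 / 2 * α₀) ^ 2 :=
      mul_le_mul_of_nonneg_left h1 (by positivity)
    linarith
  have hg0 : 0 ≤ gauss (4 * Λ)⁻¹ (Λ - 3 / 2 * α₀) := (gauss_pos _ _).le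
  have hsq : Real.sqrt (4 * π * Λ) ≤ 4 * π * Λ := by
    rw [Real.sqrt_le_iff]
    have h1 : (1 : ℝ) ≤ 4 * π * Λ := by nlinarith [Real.pi_gt_three]
    exact ⟨by positivity, by nlinarith⟩
  have hx32 : x ≤ Real.exp (Λ / 32) := by
    refine hx2.trans (Real.exp_le_exp.mpr ?_)
    have hL21 : (2 : ℝ) ^ 21 ≤ L ^ 21 := pow_le_pow_left₀ (by norm_num) hL2 21
    have : L ^ 30 = L ^ 9 * L ^ 21 := by ring
    rw [hΛdef, this]
    nlinarith [pow_pos hL0 9]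
  have he1 : Real.exp ((1 : ℝ) ^ 2 / (4 * Λ)) ≤ Real.exp 1 := by
    apply Real.exp_le_exp.mpr; rw [one_pow, div_le_one (by positivity)]; linarith
  have hΛe1 : Λ * Real.exp (-(Λ / 64)) ≤ 64 := by
    have h := pow_mul_exp_neg_le' (a := 1 / 64) (v := Λ) (by norm_num) hΛ0.le 1
    simp only [pow_one, Nat.factorial_one, Nat.cast_one] at h
    rw [show (1 : ℝ) / 64 * Λ = Λ / 64 by ring] at h
    calc Λ * Real.exp (-(Λ / 64)) ≤ 1 / (1 / 64) := h
      _ = 64 := by norm_num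
  have hΛe2 : Real.exp (-(Λ / 64)) ≤ 64 / Λ := by
    have h := exp_neg_le_inv (u := Λ / 64) (by positivity)
    rwa [one_div_div] at h
  have hexp : Real.exp (Λ / 32) * Real.exp (-(Λ / 16)) =
      Real.exp (-(Λ / 64)) * Real.exp (-(Λ / 64)) := by
    rw [← Real.exp_add, ← Real.exp_add]; congr 1; ring
  have hΛinv : 1 / Λ ≤ 1 / L ^ 9 := one_div_le_one_div_of_le (pow_pos hL0 9) hΛ9
  have hKA0 : 0 ≤ 16 * π * Real.exp 1 * 4096 := by positivity
  calc 2 * (4 * (x ^ (1 : ℝ) * Real.exp ((1 : ℝ) ^ 2 / (4 * Λ)) / 1) *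
        (gauss (4 * Λ)⁻¹ (Λ - 3 / 2 * α₀) * (Real.sqrt (4 * π * Λ) / 2)))
      = 4 * (x * (Real.exp ((1 : ℝ) ^ 2 / (4 * Λ)) *
          (gauss (4 * Λ)⁻¹ (Λ - 3 / 2 * α₀) * Real.sqrt (4 * π * Λ)))) := by
        rw [Real.rpow_one]; ring
    _ ≤ 4 * (Real.exp (Λ / 32) * (Real.exp 1 * (Real.exp (-(Λ / 16)) * (4 * π * Λ)))) := by
        gcongr
    _ = 16 * π * Real.exp 1 * ((Λ * Real.exp (-(Λ / 64))) * Real.exp (-(Λ / 64))) := by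
        rw [show Real.exp (Λ / 32) * (Real.exp 1 * (Real.exp (-(Λ / 16)) * (4 * π * Λ))) =
          Real.exp 1 * (4 * π * Λ) * (Real.exp (Λ / 32) * Real.exp (-(Λ / 16))) by ring, hexp]
        ring
    _ ≤ 16 * π * Real.exp 1 * (64 * (64 / Λ)) := by gcongr
    _ = (16 * π * Real.exp 1 * 4096) * (1 / Λ) := by ring
    _ ≤ (16 * π * Real.exp 1 * 4096) * (1 / L ^ 9) := by gcongr
    _ = (16 * π * Real.exp 1 * 4096) / L ^ 9 := by ring

/-- Term B (the left line `Re s = −η`, with the saving `x^{−η} ≤ e^{−c₂𝓛⁸}`): `≤ K_B/𝓛⁹`. [folklore] -/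
private theorem termB_le (hL2 : 2 ≤ L) (hΛdef : Λ = L ^ 30) (hcb0 : 0 < cb) (hC0 : 0 < C)
    (hx1 : Real.exp (0.4 * L ^ 9) ≤ x) (hℓH0 : 0 < ℓH) (hℓH31 : ℓH ≤ 31 * L)
    (hηdef : η = 2 * cb / ℓH) (hη0 : 0 < η) (hη1 : η < 1) (hηlow : 2 * cb / (31 * L) ≤ η)
    {M₁ : ℝ} (hM₁ : M₁ = (1 / η + C * ℓH) * (C * ℓH)) :
    M₁ * (x ^ (-η) * Real.exp ((-η) ^ 2 / (4 * Λ)) / η) * Real.sqrt (4 * π * Λ) ≤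
      (31 ^ 2 * C * (1 / (2 * cb) + C) * (62 * π * Real.exp 1 / cb) *
        (720 / (0.8 * cb / 31) ^ 6)) / L ^ 9 := by
  have hL0 : 0 < L := by linarith
  have hL1 : 1 ≤ L := by linarith
  have hΛ1 : (2 : ℝ) ^ 30 ≤ Λ := by rw [hΛdef]; exact pow_le_pow_left₀ (by norm_num) hL2 30
  have hΛ0 : 0 < Λ := by linarith [show (0:ℝ) < 2 ^ 30 by norm_num]
  set c₂ : ℝ := 0.8 * cb / 31 with hc₂
  have hc₂0 : 0 < c₂ := by rw [hc₂]; positivity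
  set K₁ : ℝ := 31 ^ 2 * C * (1 / (2 * cb) + C) with hK₁
  set K₂ : ℝ := K₁ * (62 * π * Real.exp 1 / cb) with hK₂
  have hK₁0 : 0 ≤ K₁ := by rw [hK₁]; positivity
  have hK₂0 : 0 ≤ K₂ := by rw [hK₂]; positivity
  have hx0 : 0 < x := lt_of_lt_of_le (Real.exp_pos _) hx1
  have hxη0 : 0 ≤ x ^ (-η) := Real.rpow_nonneg hx0.le _
  have hsq : Real.sqrt (4 * π * Λ) ≤ 4 * π * Λ := by
    rw [Real.sqrt_le_iff]
    have h1 : (1 : ℝ) ≤ 4 * π * Λ := by nlinarith [Real.pi_gt_three]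
    exact ⟨by positivity, by nlinarith⟩
  have hxη : x ^ (-η) ≤ Real.exp (-(c₂ * L ^ 8)) := by
    have h1 : x ^ (-η) ≤ (Real.exp (0.4 * L ^ 9)) ^ (-η) :=
      Real.rpow_le_rpow_of_nonpos (Real.exp_pos _) hx1 (by linarith)
    refine h1.trans ?_
    rw [← Real.exp_mul]
    apply Real.exp_le_exp.mpr
    have h3 : 2 * cb / (31 * L) * L ^ 9 ≤ η * L ^ 9 := mul_le_mul_of_nonneg_right hηlow (by positivity)
    have h4 : 2 * cb / (31 * L) * L ^ 9 = (2 * cb / 31) * L ^ 8 := by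
      field_simp
    rw [hc₂]
    nlinarith
  have he2 : Real.exp ((-η) ^ 2 / (4 * Λ)) ≤ Real.exp 1 := by
    apply Real.exp_le_exp.mpr; rw [div_le_one (by positivity)]; nlinarith
  have hηinv : 1 / η ≤ 31 * L / (2 * cb) := by
    rw [hηdef, one_div_div]
    exact div_le_div_of_nonneg_right hℓH31 (by positivity)
  have hM₁le : M₁ ≤ K₁ * L ^ 2 := by
    rw [hM₁, hK₁]
    have h1 : C * ℓH ≤ 31 * C * L := by nlinarith
    have h2 : 1 / η + C * ℓH ≤ (31 / (2 * cb) + 31 * C) * L := by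
      have : 31 * L / (2 * cb) = 31 / (2 * cb) * L := by ring
      linarith
    calc (1 / η + C * ℓH) * (C * ℓH) ≤ ((31 / (2 * cb) + 31 * C) * L) * (31 * C * L) :=
        mul_le_mul h2 h1 (by positivity) (by positivity)
      _ = 31 ^ 2 * C * (1 / (2 * cb) + C) * L ^ 2 := by ring
  have hM₁0 : 0 ≤ M₁ := by rw [hM₁]; positivity
  have hL33 : L ^ 33 * Real.exp (-(c₂ * L ^ 8)) ≤ 720 / (c₂ ^ 6 * L ^ 9) := by
    have h := pow_mul_exp_neg_le' hc₂0 (pow_nonneg hL0.le 8) 6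
    have hf : ((Nat.factorial 6 : ℕ) : ℝ) = 720 := by norm_num [Nat.factorial]
    rw [hf, ← pow_mul] at h
    norm_num at h
    have hL15 : L ^ 9 ≤ L ^ 15 := pow_le_pow_right₀ hL1 (by norm_num)
    rw [le_div_iff₀ (by positivity)]
    calc L ^ 33 * Real.exp (-(c₂ * L ^ 8)) * (c₂ ^ 6 * L ^ 9)
        ≤ L ^ 33 * Real.exp (-(c₂ * L ^ 8)) * (c₂ ^ 6 * L ^ 15) := by gcongr
      _ = (L ^ 48 * Real.exp (-(c₂ * L ^ 8))) * c₂ ^ 6 := by ring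
      _ ≤ (720 / c₂ ^ 6) * c₂ ^ 6 := by gcongr
      _ = 720 := by field_simp
  calc M₁ * (x ^ (-η) * Real.exp ((-η) ^ 2 / (4 * Λ)) / η) * Real.sqrt (4 * π * Λ)
      = M₁ * (x ^ (-η) * Real.exp ((-η) ^ 2 / (4 * Λ)) * (1 / η)) * Real.sqrt (4 * π * Λ) := by ring
    _ ≤ (K₁ * L ^ 2) * (Real.exp (-(c₂ * L ^ 8)) * Real.exp 1 * (31 * L / (2 * cb))) *
          (4 * π * Λ) := by gcongr
    _ = K₂ * (L ^ 33 * Real.exp (-(c₂ * L ^ 8))) := by rw [hK₂, hK₁, hΛdef]; field_simp; ring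
    _ ≤ K₂ * (720 / (c₂ ^ 6 * L ^ 9)) := by gcongr
    _ = K₂ * (720 / c₂ ^ 6) / L ^ 9 := by field_simp

/-- Term C (the horizontal segments `Im s = ±Λ`): `≤ 256e·K₃/𝓛⁹`. [folklore] -/
private theorem termC_le (hL2 : 2 ≤ L) (hΛdef : Λ = L ^ 30) (hC0 : 0 < C) {α₀ : ℝ} (hα0 : 0 < α₀)
    (hα1 : α₀ < 1 / 100) (hx1 : Real.exp (0.4 * L ^ 9) ≤ x) (hx2 : x ≤ Real.exp (0.504 * L ^ 9))
    (hℓH0 : 0 < ℓH) (hℓH31 : ℓH ≤ 31 * L) (hη0 : 0 < η) (hη1 : η < 1)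
    {M₂ : ℝ} (hM₂ : M₂ = (1 + C * ℓH) * (C * ℓH)) :
    2 * ((1 - -η) * (M₂ * (max (x ^ (-η)) (x ^ (1 : ℝ)) *
        Real.exp (max ((-η) ^ 2) ((1 : ℝ) ^ 2) / (4 * Λ)) * gauss (4 * Λ)⁻¹ (Λ - 3 / 2 * α₀) /
          (Λ - 3 / 2 * α₀)))) ≤
      (256 * Real.exp 1 * (31 * C * (1 + 31 * C))) / L ^ 9 := by
  have hL0 : 0 < L := by linarith
  have hL1 : 1 ≤ L := by linarith
  have hΛ1 : (2 : ℝ) ^ 30 ≤ Λ := by rw [hΛdef]; exact pow_le_pow_left₀ (by norm_num) hL2 30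
  have hΛ0 : 0 < Λ := by linarith [show (0:ℝ) < 2 ^ 30 by norm_num]
  have hΛ9 : L ^ 9 ≤ Λ := by rw [hΛdef]; exact pow_le_pow_right₀ hL1 (by norm_num)
  have hΛ2L : L ^ 2 ≤ Λ := by rw [hΛdef]; exact pow_le_pow_right₀ hL1 (by norm_num)
  set K₃ : ℝ := 31 * C * (1 + 31 * C) with hK₃
  have hK₃0 : 0 ≤ K₃ := by rw [hK₃]; positivity
  have hx1' : 1 ≤ x := le_trans (Real.one_le_exp (by positivity)) hx1
  have hHb : Λ / 2 ≤ Λ - 3 / 2 * α₀ := by nlinarith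
  have hHb0 : 0 < Λ - 3 / 2 * α₀ := by linarith
  have hg : gauss (4 * Λ)⁻¹ (Λ - 3 / 2 * α₀) ≤ Real.exp (-(Λ / 16)) := by
    rw [gauss]
    apply Real.exp_le_exp.mpr
    have h1 : (Λ / 2) ^ 2 ≤ (Λ - 3 / 2 * α₀) ^ 2 := pow_le_pow_left₀ (by positivity) hHb 2
    have h2 : (4 * Λ)⁻¹ * (Λ / 2) ^ 2 = Λ / 16 := by field_simp; ring
    have h3 : (4 * Λ)⁻¹ * (Λ / 2) ^ 2 ≤ (4 * Λ)⁻¹ * (Λ - 3 / 2 * α₀) ^ 2 :=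
      mul_le_mul_of_nonneg_left h1 (by positivity)
    linarith
  have hg0 : 0 ≤ gauss (4 * Λ)⁻¹ (Λ - 3 / 2 * α₀) := (gauss_pos _ _).le
  have hx32 : x ≤ Real.exp (Λ / 32) := by
    refine hx2.trans (Real.exp_le_exp.mpr ?_)
    have hL21 : (2 : ℝ) ^ 21 ≤ L ^ 21 := pow_le_pow_left₀ (by norm_num) hL2 21
    have : L ^ 30 = L ^ 9 * L ^ 21 := by ring
    rw [hΛdef, this]
    nlinarith [pow_pos hL0 9]
  have hxη1 : x ^ (-η) ≤ x := by
    calc x ^ (-η) ≤ 1 := Real.rpow_le_one_of_one_le_of_nonpos hx1' (by linarith)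
      _ ≤ x := hx1'
  have hmx : max (x ^ (-η)) (x ^ (1 : ℝ)) ≤ Real.exp (Λ / 32) := by
    rw [Real.rpow_one]; exact max_le (hxη1.trans hx32) hx32
  have hmx0 : 0 ≤ max (x ^ (-η)) (x ^ (1 : ℝ)) := le_max_of_le_right (by rw [Real.rpow_one]; linarith)
  have he3 : Real.exp (max ((-η) ^ 2) ((1 : ℝ) ^ 2) / (4 * Λ)) ≤ Real.exp 1 := by
    apply Real.exp_le_exp.mpr; rw [div_le_one (by positivity)]
    have : max ((-η) ^ 2) ((1 : ℝ) ^ 2) ≤ 1 := max_le (by nlinarith) (by norm_num)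
    linarith
  have hM₂le : M₂ ≤ K₃ * L ^ 2 := by
    rw [hM₂, hK₃]
    have h1 : C * ℓH ≤ 31 * C * L := by nlinarith
    have h2 : 1 + C * ℓH ≤ (1 + 31 * C) * L := by nlinarith
    calc (1 + C * ℓH) * (C * ℓH) ≤ ((1 + 31 * C) * L) * (31 * C * L) :=
        mul_le_mul h2 h1 (by positivity) (by positivity)
      _ = 31 * C * (1 + 31 * C) * L ^ 2 := by ring
  have hM₂0 : 0 ≤ M₂ := by rw [hM₂]; positivity
  have hΛe3 : Real.exp (-(Λ / 32)) ≤ 32 / Λ := by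
    have h := exp_neg_le_inv (u := Λ / 32) (by positivity)
    rwa [one_div_div] at h
  have hexp : Real.exp (Λ / 32) * Real.exp (-(Λ / 16)) = Real.exp (-(Λ / 32)) := by
    rw [← Real.exp_add]; congr 1; ring
  have hL2Λ : L ^ 2 / Λ ≤ 1 := by rw [div_le_one hΛ0]; exact hΛ2L
  have hΛinv : 1 / Λ ≤ 1 / L ^ 9 := one_div_le_one_div_of_le (pow_pos hL0 9) hΛ9
  have hη2 : 1 - -η ≤ 2 := by linarith
  calc 2 * ((1 - -η) * (M₂ * (max (x ^ (-η)) (x ^ (1 : ℝ)) *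
        Real.exp (max ((-η) ^ 2) ((1 : ℝ) ^ 2) / (4 * Λ)) * gauss (4 * Λ)⁻¹ (Λ - 3 / 2 * α₀) /
          (Λ - 3 / 2 * α₀))))
      ≤ 2 * (2 * ((K₃ * L ^ 2) * (Real.exp (Λ / 32) * Real.exp 1 * Real.exp (-(Λ / 16)) /
          (Λ / 2)))) := by gcongr
    _ = 8 * Real.exp 1 * K₃ * (L ^ 2 / Λ) * (Real.exp (Λ / 32) * Real.exp (-(Λ / 16))) := by
        field_simp; ring
    _ = 8 * Real.exp 1 * K₃ * (L ^ 2 / Λ) * Real.exp (-(Λ / 32)) := by rw [hexp]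
    _ ≤ 8 * Real.exp 1 * K₃ * 1 * (32 / Λ) := by gcongr
    _ = (256 * Real.exp 1 * K₃) * (1 / Λ) := by ring
    _ ≤ (256 * Real.exp 1 * K₃) * (1 / L ^ 9) := by gcongr
    _ = (256 * Real.exp 1 * K₃) / L ^ 9 := by ring

/-- The whole error bound of the Landau rectangle is `≤ C₀·α` (`α = π/𝓛⁹`). [folklore] -/
private theorem engine_rhs_le (hL2 : 2 ≤ L) (hΛdef : Λ = L ^ 30) (hcb0 : 0 < cb)
    (hC0 : 0 < C) {α₀ : ℝ} (hα : α₀ = π / L ^ 9) (hα0 : 0 < α₀) (hα1 : α₀ < 1 / 100)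
    (hx1 : Real.exp (0.4 * L ^ 9) ≤ x) (hx2 : x ≤ Real.exp (0.504 * L ^ 9))
    (hℓH0 : 0 < ℓH) (hℓH31 : ℓH ≤ 31 * L) (hηdef : η = 2 * cb / ℓH) (hη0 : 0 < η) (hη1 : η < 1)
    (hηlow : 2 * cb / (31 * L) ≤ η)
    {M₁ M₂ : ℝ} (hM₁ : M₁ = (1 / η + C * ℓH) * (C * ℓH)) (hM₂ : M₂ = (1 + C * ℓH) * (C * ℓH)) :
    1 / (2 * π) * (2 * (4 * (x ^ (1 : ℝ) * Real.exp ((1 : ℝ) ^ 2 / (4 * Λ)) / 1) *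
          (gauss (4 * Λ)⁻¹ (Λ - 3 / 2 * α₀) * (Real.sqrt (4 * π * Λ) / 2))) +
        M₁ * (x ^ (-η) * Real.exp ((-η) ^ 2 / (4 * Λ)) / η) * Real.sqrt (4 * π * Λ) +
        2 * ((1 - -η) * (M₂ * (max (x ^ (-η)) (x ^ (1 : ℝ)) *
          Real.exp (max ((-η) ^ 2) ((1 : ℝ) ^ 2) / (4 * Λ)) * gauss (4 * Λ)⁻¹ (Λ - 3 / 2 * α₀) /
            (Λ - 3 / 2 * α₀))))) ≤
      (16 * π * Real.exp 1 * 4096 +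
          31 ^ 2 * C * (1 / (2 * cb) + C) * (62 * π * Real.exp 1 / cb) * (720 / (0.8 * cb / 31) ^ 6) +
          256 * Real.exp 1 * (31 * C * (1 + 31 * C))) / (2 * π ^ 2) * α₀ := by
  have hL0 : 0 < L := by linarith
  have hA := termA_le hL2 hΛdef hα0 hα1 hx2
  have hB := termB_le hL2 hΛdef hcb0 hC0 hx1 hℓH0 hℓH31 hηdef hη0 hη1 hηlow hM₁
  have hC := termC_le hL2 hΛdef hC0 hα0 hα1 hx1 hx2 hℓH0 hℓH31 hη0 hη1 hM₂
  set KA : ℝ := 16 * π * Real.exp 1 * 4096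
  set KB : ℝ := 31 ^ 2 * C * (1 / (2 * cb) + C) * (62 * π * Real.exp 1 / cb) * (720 / (0.8 * cb / 31) ^ 6)
  set KC : ℝ := 256 * Real.exp 1 * (31 * C * (1 + 31 * C))
  have hsum := add_le_add (add_le_add hA hB) hC
  have hπ : 0 ≤ 1 / (2 * π) := by positivity
  calc _ ≤ 1 / (2 * π) * (KA / L ^ 9 + KB / L ^ 9 + KC / L ^ 9) := mul_le_mul_of_nonneg_left hsum hπ
    _ = (KA + KB + KC) / (2 * π ^ 2) * α₀ := by rw [hα]; field_simp

end Numeric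

/-! ## The single-`x` contour estimate -/

set_option maxHeartbeats 1600000 in -- one long contour bookkeeping (zero-free region, two residues, four pieces)
/-- **The inner contour shift of `Z22:§B.u015` with explicit `O(α)` error.** For every `c′` there are
`C₀ ≥ 0` and `L₀` such that for `𝓛 = log D ≥ L₀`, `j ∈ {1,2,3}` and `e^{0.4𝓛⁹} ≤ x ≤ e^{0.504𝓛⁹}`:
with `Φ(s) = x^{β₆}ζ(1+s)(s−β_j)/ζ₁(1+s−β_j)` and `K(s) = x^{s−β₆}ω₁(s−β₆)/(s−β₆)` (`ω₁` of (4.1) with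
`Λ = 𝓛³⁰`; so `Φ·K = xˢζ(1+s)ζ(1+s−β_j)⁻¹ω₁(s−β₆)(s−β₆)⁻¹` off `s = β_j`),
`‖(1/2π)∫_ℝ Φ(1+it)K(1+it)dt − (R₀ + R_β(x))‖ ≤ C₀·α`, where `R₀ = (β_j/β₆)·ω₁(−β₆)/ζ₁(1−β_j)` (the
residue at `s = 0`) and `R_β(x) = x^{β₆}ζ(1+β₆)(β₆−β_j)/ζ₁(1+β₆−β_j)` (the residue at `s = β₆`) —
Landau's rectangle `[−η, 1] × [−𝓛³⁰, 𝓛³⁰]`, `η = 2c̄/log(𝓛³⁰+5)`, in the classical zero-free region.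
[cite: Zhang2022LandauSiegel, App. B p.108] [cite: MontgomeryVaughan2007, §6.2] -/
theorem lineIntegral_sub_residues_le (c' : ℝ) :
    ∃ C₀ : ℝ, 0 ≤ C₀ ∧ ∃ L₀ : ℝ, ∀ (D : ℕ), L₀ ≤ ell D → ∀ (j : ℕ), j ∈ ({1, 2, 3} : Finset ℕ) →
      ∀ (x : ℝ), Real.exp (0.4 * ell D ^ 9) ≤ x → x ≤ Real.exp (0.504 * ell D ^ 9) →
        ‖(1 / (2 * π) : ℂ) * (∫ t : ℝ,
            ((x : ℂ) ^ beta6 D * riemannZeta (1 + (((1 : ℝ) : ℂ) + t * I)) *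
                (((((1 : ℝ) : ℂ) + t * I) - betaJ c' D j) /
                  riemannZeta₁ (1 + (((1 : ℝ) : ℂ) + t * I) - betaJ c' D j))) *
              ((x : ℂ) ^ ((((1 : ℝ) : ℂ) + t * I) + -beta6 D) *
                omega1 (ell D ^ 30) ((((1 : ℝ) : ℂ) + t * I) + -beta6 D) /
                ((((1 : ℝ) : ℂ) + t * I) + -beta6 D))) -
          (betaJ c' D j / beta6 D * (omega1 (ell D ^ 30) (-beta6 D) / riemannZeta₁ (1 - betaJ c' D j)) +
            (x : ℂ) ^ beta6 D * riemannZeta (1 + beta6 D) *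
              ((beta6 D - betaJ c' D j) / riemannZeta₁ (1 + beta6 D - betaJ c' D j)))‖ ≤
          C₀ * alpha D := by
  obtain ⟨cb, hcb0, hcb1, C, hC0, hZ⟩ := ZetaClassicalRegion.exists_zeroFreeRegion_bounds
  refine ⟨(16 * π * Real.exp 1 * 4096 +
      31 ^ 2 * C * (1 / (2 * cb) + C) * (62 * π * Real.exp 1 / cb) * (720 / (0.8 * cb / 31) ^ 6) +
      256 * Real.exp 1 * (31 * C * (1 + 31 * C))) / (2 * π ^ 2), by positivity,
    max 2 (60 * |c'| * π + 1), ?_⟩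
  intro D hL j hj x hx1 hx2
  -- the modulus parameters
  set L : ℝ := ell D with hLdef
  have hL2 : 2 ≤ L := le_trans (le_max_left _ _) hL
  have hL1 : 1 ≤ L := by linarith
  have hL0 : 0 < L := by linarith
  have hD3 : 3 ≤ D := by
    by_contra hlt
    have hD2 : (D : ℝ) ≤ 2 := by exact_mod_cast (by omega : D ≤ 2)
    have : L ≤ Real.log 2 := by
      rw [hLdef, ell]
      rcases Nat.eq_zero_or_pos D with h0 | hpos
      · rw [h0]; simp; exact Real.log_nonneg (by norm_num)
      · exact Real.log_le_log (by exact_mod_cast hpos) hD2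
    linarith [Real.log_two_lt_d9]
  have hαdef : alpha D = π / L ^ 9 := by rw [alpha, bigP, Real.log_exp]
  have hα0 : 0 < alpha D := by rw [hαdef]; positivity
  have hαle : alpha D ≤ π / 512 := by
    rw [hαdef]
    have : (512 : ℝ) ≤ L ^ 9 := by
      calc (512 : ℝ) = 2 ^ 9 := by norm_num
        _ ≤ L ^ 9 := pow_le_pow_left₀ (by norm_num) hL2 9
    exact div_le_div_of_nonneg_left Real.pi_pos.le (by norm_num) this
  have hπ4 : π < 4 := Real.pi_lt_four
  have hα1 : alpha D < 1 / 100 := by linarith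
  -- `60|c'|α𝓛 ≤ 1`
  have hc60 : 60 * |c'| * (alpha D * ell D) ≤ 1 := by
    rw [hαdef, ← hLdef]
    have hL8 : 60 * |c'| * π + 1 ≤ L ^ 8 := by
      calc 60 * |c'| * π + 1 ≤ L := le_trans (le_max_right _ _) hL
        _ = L ^ 1 := (pow_one L).symm
        _ ≤ L ^ 8 := pow_le_pow_right₀ hL1 (by norm_num)
    have hL9 : L ^ 9 = L ^ 8 * L := by ring
    rw [show π / L ^ 9 * L = π / L ^ 8 by rw [hL9]; field_simp]
    rw [show 60 * |c'| * (π / L ^ 8) = (60 * |c'| * π) / L ^ 8 by ring,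
      div_le_one (by positivity)]
    linarith
  set Λ : ℝ := L ^ 30 with hΛdef
  have hΛ1 : (2 : ℝ) ^ 30 ≤ Λ := pow_le_pow_left₀ (by norm_num) hL2 30
  have hΛ0 : 0 < Λ := by linarith [show (0:ℝ) < 2 ^ 30 by norm_num]
  have hΛL : L ≤ Λ := by
    calc L = L ^ 1 := (pow_one L).symm
      _ ≤ L ^ 30 := pow_le_pow_right₀ hL1 (by norm_num)
  have hΛ9 : L ^ 9 ≤ Λ := pow_le_pow_right₀ hL1 (by norm_num)
  have hΛ2L : L ^ 2 ≤ Λ := pow_le_pow_right₀ hL1 (by norm_num)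
  -- `β₆`, `β_j`
  set β : ℂ := beta6 D with hβdef
  have hβ : β = ((3 / 2 * alpha D : ℝ) : ℂ) * I := by rw [hβdef, beta6]; push_cast; ring
  have hβre : (-β).re = 0 := by rw [hβ]; simp
  have hβim : (-β).im = -(3 / 2 * alpha D) := by rw [hβ]; simp
  have hβim' : |(-β).im| = 3 / 2 * alpha D := by rw [hβim, abs_neg, abs_of_pos (by positivity)]
  have hβ0 : β ≠ 0 := by
    rw [hβ]; intro h
    have := congrArg Complex.im h
    simp at this
    linarith
  set βj : ℂ := betaJ c' D j with hβjdef
  obtain ⟨bj, hbj, hbjle⟩ := betaJ_bound c' D j hα0.le (by rw [← hLdef]; exact hL0.le)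
  have hbj1 : |bj| ≤ 1 := by
    have h1 : 5 * |c'| * alpha D * ell D ≤ 1 / 12 := by
      have : 5 * |c'| * alpha D * ell D = (60 * |c'| * (alpha D * ell D)) / 12 := by ring
      rw [this]; linarith
    calc |bj| ≤ 3 * alpha D * (1 + 5 * |c'| * alpha D * ell D) := hbjle
      _ ≤ 3 * (1 / 100) * (1 + 1 / 12) := by gcongr
      _ ≤ 1 := by norm_num
  have hβjre : βj.re = 0 := by rw [hβjdef, hbj]; simp
  have hβjim : βj.im = bj := by rw [hβjdef, hbj]; simp
  -- the contour parameters (`Λ = Λ`)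
  set ℓH : ℝ := Real.log (Λ + 5) with hℓH
  have hℓH5 : Real.log 5 ≤ ℓH := by
    rw [hℓH]; exact Real.log_le_log (by norm_num) (by linarith)
  have hlog5 : (1 : ℝ) < Real.log 5 := by
    rw [Real.lt_log_iff_exp_lt (by norm_num)]
    have := Real.exp_one_lt_d9; linarith
  have hℓH1 : 1 < ℓH := lt_of_lt_of_le hlog5 hℓH5
  have hℓH0 : 0 < ℓH := by linarith
  have hℓH31 : ℓH ≤ 31 * L := by rw [hℓH, hΛdef]; exact log_pow_thirty_add_five_le hL2
  set η : ℝ := 2 * cb / ℓH with hηdef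
  have hη0 : 0 < η := by rw [hηdef]; positivity
  have hη1 : η < 1 := by
    rw [hηdef, div_lt_one hℓH0]
    calc 2 * cb ≤ 2 * (1 / 100) := by gcongr
      _ < 1 := by norm_num
      _ < ℓH := hℓH1
  have hηlow : 2 * cb / (31 * L) ≤ η := by
    rw [hηdef]; exact div_le_div_of_nonneg_left (by positivity) hℓH0 hℓH31
  -- monotonicity of `4c̄/log(·+3)`: points with `|Im| ≤ Λ + 2` and `Re ≥ −2η`-type conditions
  have hzfr_of : ∀ w : ℂ, w ≠ 1 → |w.im| ≤ Λ + 2 → 1 - 2 * η ≤ w.re →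
      riemannZeta w ≠ 0 ∧ ‖riemannZeta w - 1 / (w - 1)‖ ≤ C * ℓH ∧ ‖(riemannZeta w)⁻¹‖ ≤ C * ℓH := by
    intro w hw1 hwim hwre
    have hlogle : Real.log (|w.im| + 3) ≤ ℓH := by
      rw [hℓH]; exact Real.log_le_log (by positivity) (by linarith)
    have hlogpos : 0 < Real.log (|w.im| + 3) := Real.log_pos (by linarith [abs_nonneg w.im])
    have hcond : 1 - 4 * cb / Real.log (|w.im| + 3) ≤ w.re := by
      have h1 : 4 * cb / ℓH ≤ 4 * cb / Real.log (|w.im| + 3) :=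
        div_le_div_of_nonneg_left (by positivity) hlogpos hlogle
      have h2 : 2 * η = 4 * cb / ℓH := by rw [hηdef]; ring
      linarith
    obtain ⟨hne, hsub, hinv, -⟩ := hZ w hw1 hcond
    refine ⟨hne, hsub.trans ?_, hinv.trans ?_⟩ <;>
      exact mul_le_mul_of_nonneg_left hlogle hC0.le
  -- the objects
  have hx0 : 0 < x := lt_of_lt_of_le (Real.exp_pos _) hx1
  have hx1' : 1 ≤ x := le_trans (Real.one_le_exp (by positivity)) hx1
  have hxC : (x : ℂ) ≠ 0 := by exact_mod_cast hx0.ne'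
  obtain ⟨Φ, hΦdef⟩ : ∃ Φ : ℂ → ℂ, Φ = fun z => (x : ℂ) ^ β * riemannZeta (1 + z) *
    ((z - βj) / riemannZeta₁ (1 + z - βj)) := ⟨_, rfl⟩
  have hxβ : ‖(x : ℂ) ^ β‖ = 1 := by
    rw [Complex.norm_cpow_eq_rpow_re_of_pos hx0, hβ]; simp
  -- `Φ` in terms of `1/ζ` off `βj`
  have hΦ_eq : ∀ z : ℂ, z ≠ βj → Φ z = (x : ℂ) ^ β * riemannZeta (1 + z) * (riemannZeta (1 + z - βj))⁻¹ := by
    intro z hz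
    have hw : 1 + z - βj ≠ 1 := by
      intro h; apply hz; linear_combination h
    rw [hΦdef]; dsimp only
    rw [inv_riemannZeta_eq_div_zeta₁ hw]
    congr 2
    ring
  have hnormΦ : ∀ z : ℂ, z ≠ βj →
      ‖Φ z‖ = ‖riemannZeta (1 + z)‖ * ‖(riemannZeta (1 + z - βj))⁻¹‖ := by
    intro z hz
    rw [hΦ_eq z hz, norm_mul, norm_mul, hxβ, one_mul]
  -- `ζ₁(1 + z − βj) ≠ 0` on the region `U`
  set U : Set ℂ := {z : ℂ | -(2 * η) < z.re ∧ |z.im| < Λ + 1} with hUdef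
  have hUopen : IsOpen U := by
    have h1 : IsOpen {z : ℂ | -(2 * η) < z.re} := isOpen_lt continuous_const Complex.continuous_re
    have h2 : IsOpen {z : ℂ | |z.im| < Λ + 1} :=
      isOpen_lt (continuous_abs.comp Complex.continuous_im) continuous_const
    exact h1.inter h2
  have hζ₁U : ∀ z ∈ U, riemannZeta₁ (1 + z - βj) ≠ 0 := by
    intro z hz
    refine riemannZeta₁_ne_zero_of fun hw => ?_
    have him : |(1 + z - βj).im| ≤ Λ + 2 := by
      have : (1 + z - βj).im = z.im - bj := by simp [hβjim]
      rw [this]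
      calc |z.im - bj| ≤ |z.im| + |bj| := abs_sub _ _
        _ ≤ (Λ + 1) + 1 := add_le_add hz.2.le hbj1
        _ = Λ + 2 := by ring
    have hre : 1 - 2 * η ≤ (1 + z - βj).re := by
      have : (1 + z - βj).re = 1 + z.re := by simp [hβjre]
      rw [this]; linarith [hz.1]
    exact (hzfr_of _ hw him hre).1
  -- differentiability of `Φ` where `z ≠ 0` and `ζ₁(1+z−βj) ≠ 0`
  have hΦdiff : ∀ z : ℂ, z ≠ 0 → riemannZeta₁ (1 + z - βj) ≠ 0 → DifferentiableAt ℂ Φ z := by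
    intro z hz0 hζ
    have h1 : DifferentiableAt ℂ (fun z : ℂ => riemannZeta (1 + z)) z := by
      have h := differentiableAt_riemannZeta (s := 1 + z) (by intro h; apply hz0; linear_combination h)
      exact h.comp z (by fun_prop)
    have h2 : DifferentiableAt ℂ (fun z : ℂ => riemannZeta₁ (1 + z - βj)) z :=
      (differentiable_riemannZeta₁.differentiableAt).comp z
        ((differentiableAt_id.const_add (1 : ℂ)).sub_const βj)
    have h3 : DifferentiableAt ℂ (fun z : ℂ => (z - βj) / riemannZeta₁ (1 + z - βj)) z :=
      (differentiableAt_id.sub_const βj).div h2 hζ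
    rw [hΦdef]
    exact ((differentiableAt_const _).mul h1).mul h3
  -- continuity and bound of `Φ` on the line `Re z = 1`
  have hline_ne : ∀ t : ℝ, (((1 : ℝ) : ℂ) + t * I) ≠ βj := by
    intro t h; have := congrArg Complex.re h; simp [hβjre] at this
  have hline_re2 : ∀ t : ℝ, (1 + ((((1 : ℝ) : ℂ) + t * I) - βj)).re = 2 := by
    intro t; simp [hβjre]; norm_num
  have hζ₁line : ∀ t : ℝ, riemannZeta₁ (1 + (((1 : ℝ) : ℂ) + t * I) - βj) ≠ 0 := by
    intro t
    refine riemannZeta₁_ne_zero_of fun _ => riemannZeta_ne_zero_of_one_le_re ?_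
    rw [show (1 + (((1 : ℝ) : ℂ) + t * I) - βj) = 1 + ((((1 : ℝ) : ℂ) + t * I) - βj) by ring,
      hline_re2]; norm_num
  have hΦcont : Continuous fun t : ℝ => Φ (((1 : ℝ) : ℂ) + t * I) := by
    have hl : Continuous fun t : ℝ => (((1 : ℝ) : ℂ) + t * I) := by fun_prop
    refine continuous_iff_continuousAt.mpr fun t => ?_
    have hz0 : (((1 : ℝ) : ℂ) + t * I) ≠ 0 := by
      intro h; have := congrArg Complex.re h; simp at this
    exact ContinuousAt.comp (g := Φ) (f := fun t : ℝ => (((1 : ℝ) : ℂ) + t * I))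
      (hΦdiff _ hz0 (hζ₁line t)).continuousAt hl.continuousAt
  have hΦ₀ : ∀ t : ℝ, ‖Φ (((1 : ℝ) : ℂ) + t * I)‖ ≤ 4 := by
    intro t
    rw [hnormΦ _ (hline_ne t)]
    have hre1 : (1 + (((1 : ℝ) : ℂ) + t * I)).re = 2 := by simp; norm_num
    have hre2 : (1 + (((1 : ℝ) : ℂ) + t * I) - βj).re = 2 := by simp [hβjre]; norm_num
    have b1 := (norm_zeta_and_inv_le_two hre1).1
    have b2 := (norm_zeta_and_inv_le_two hre2).2
    calc ‖riemannZeta (1 + (((1 : ℝ) : ℂ) + t * I))‖ * ‖(riemannZeta (1 + (((1 : ℝ) : ℂ) + t * I) - βj))⁻¹‖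
        ≤ 2 * 2 := mul_le_mul b1 b2 (norm_nonneg _) (by norm_num)
      _ = 4 := by norm_num
  -- the bound `M₁` on the left line `Re z = −η`, `|t| ≤ Λ`
  set M₁ : ℝ := (1 / η + C * ℓH) * (C * ℓH) with hM₁
  have hM₁0 : 0 ≤ M₁ := by rw [hM₁]; positivity
  have hΦ₁ : ∀ t : ℝ, |t| ≤ Λ → ‖Φ (((-η : ℝ) : ℂ) + t * I)‖ ≤ M₁ := by
    intro t ht
    have hne : (((-η : ℝ) : ℂ) + t * I) ≠ βj := by
      intro h; have := congrArg Complex.re h; simp [hβjre] at this; linarith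
    rw [hnormΦ _ hne]
    -- numerator `ζ(1 − η + it)`
    set w₁ : ℂ := 1 + (((-η : ℝ) : ℂ) + t * I) with hw₁
    have hw₁1 : w₁ ≠ 1 := by
      intro h; have := congrArg Complex.re h; simp [hw₁] at this; linarith
    have hw₁im : |w₁.im| ≤ Λ + 2 := by
      have : w₁.im = t := by simp [hw₁]
      rw [this]; linarith
    have hw₁re : 1 - 2 * η ≤ w₁.re := by
      have : w₁.re = 1 - η := by simp [hw₁]; ring
      rw [this]; linarith
    obtain ⟨-, hsub₁, -⟩ := hzfr_of w₁ hw₁1 hw₁im hw₁re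
    have hnum : ‖riemannZeta w₁‖ ≤ 1 / η + C * ℓH := by
      have h1 : ‖(1 : ℂ) / (w₁ - 1)‖ ≤ 1 / η := by
        have hw : w₁ - 1 = (((-η : ℝ) : ℂ) + t * I) := by rw [hw₁]; ring
        rw [hw, norm_div, norm_one]
        apply div_le_div_of_nonneg_left zero_le_one hη0
        calc η = |(((-η : ℝ) : ℂ) + t * I).re| := by simp [abs_of_pos hη0]
          _ ≤ ‖(((-η : ℝ) : ℂ) + t * I)‖ := Complex.abs_re_le_norm _
      calc ‖riemannZeta w₁‖ = ‖(riemannZeta w₁ - 1 / (w₁ - 1)) + 1 / (w₁ - 1)‖ := by ring_nf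
        _ ≤ ‖riemannZeta w₁ - 1 / (w₁ - 1)‖ + ‖(1 : ℂ) / (w₁ - 1)‖ := norm_add_le _ _
        _ ≤ C * ℓH + 1 / η := add_le_add hsub₁ h1
        _ = 1 / η + C * ℓH := by ring
    -- denominator `1/ζ(1 − η + i(t − bj))`
    set w₂ : ℂ := 1 + (((-η : ℝ) : ℂ) + t * I) - βj with hw₂
    have hw₂1 : w₂ ≠ 1 := by
      intro h; have := congrArg Complex.re h; simp [hw₂, hβjre] at this; linarith
    have hw₂im : |w₂.im| ≤ Λ + 2 := by
      have : w₂.im = t - bj := by simp [hw₂, hβjim]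
      rw [this]
      calc |t - bj| ≤ |t| + |bj| := abs_sub _ _
        _ ≤ Λ + 1 := add_le_add ht hbj1
        _ ≤ Λ + 2 := by linarith
    have hw₂re : 1 - 2 * η ≤ w₂.re := by
      have : w₂.re = 1 - η := by simp [hw₂, hβjre]; ring
      rw [this]; linarith
    obtain ⟨-, -, hinv₂⟩ := hzfr_of w₂ hw₂1 hw₂im hw₂re
    rw [hM₁]
    exact mul_le_mul hnum hinv₂ (norm_nonneg _) (by positivity)
  -- the bound `M₂` on the horizontal segments `Im z = ±Λ`, `Re z ∈ [−η, 1]`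
  set M₂ : ℝ := (1 + C * ℓH) * (C * ℓH) with hM₂
  have hM₂0 : 0 ≤ M₂ := by rw [hM₂]; positivity
  have hH1 : 1 ≤ Λ := by linarith [show (1:ℝ) ≤ 2 ^ 30 by norm_num]
  have hΦ₂ : ∀ u : ℝ, -η ≤ u → u ≤ 1 → ∀ T' : ℝ, |T'| = Λ →
      ‖Φ ((u : ℂ) + (T' : ℂ) * I)‖ ≤ M₂ := by
    intro u hu1 hu2 T' hT'
    have hne : ((u : ℂ) + (T' : ℂ) * I) ≠ βj := by
      intro h; have := congrArg Complex.im h; simp [hβjim] at this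
      have : |bj| = Λ := by rw [← this, hT']
      linarith
    rw [hnormΦ _ hne]
    set w₁ : ℂ := 1 + ((u : ℂ) + (T' : ℂ) * I) with hw₁
    have hw₁1 : w₁ ≠ 1 := by
      intro h; have := congrArg Complex.im h; simp [hw₁] at this
      rw [this, abs_zero] at hT'; linarith
    have hw₁im : |w₁.im| ≤ Λ + 2 := by
      have : w₁.im = T' := by simp [hw₁]
      rw [this, hT']; linarith
    have hw₁re : 1 - 2 * η ≤ w₁.re := by
      have : w₁.re = 1 + u := by simp [hw₁]
      rw [this]; linarith
    obtain ⟨-, hsub₁, -⟩ := hzfr_of w₁ hw₁1 hw₁im hw₁re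
    have hnum : ‖riemannZeta w₁‖ ≤ 1 + C * ℓH := by
      have h1 : ‖(1 : ℂ) / (w₁ - 1)‖ ≤ 1 := by
        have hw : w₁ - 1 = ((u : ℂ) + (T' : ℂ) * I) := by rw [hw₁]; ring
        rw [hw, norm_div, norm_one, div_le_one (norm_pos_iff.mpr (by
          intro h; have := congrArg Complex.im h; simp at this; rw [this, abs_zero] at hT'; linarith))]
        calc (1 : ℝ) ≤ Λ := hH1
          _ = |((u : ℂ) + (T' : ℂ) * I).im| := by simp [hT']
          _ ≤ ‖((u : ℂ) + (T' : ℂ) * I)‖ := Complex.abs_im_le_norm _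
      calc ‖riemannZeta w₁‖ = ‖(riemannZeta w₁ - 1 / (w₁ - 1)) + 1 / (w₁ - 1)‖ := by ring_nf
        _ ≤ ‖riemannZeta w₁ - 1 / (w₁ - 1)‖ + ‖(1 : ℂ) / (w₁ - 1)‖ := norm_add_le _ _
        _ ≤ C * ℓH + 1 := add_le_add hsub₁ h1
        _ = 1 + C * ℓH := by ring
    set w₂ : ℂ := 1 + ((u : ℂ) + (T' : ℂ) * I) - βj with hw₂
    have hw₂1 : w₂ ≠ 1 := by
      intro h; have := congrArg Complex.im h; simp [hw₂, hβjim] at this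
      have : |T'| ≤ 1 := by rw [show T' = bj by linarith]; exact hbj1
      linarith
    have hw₂im : |w₂.im| ≤ Λ + 2 := by
      have : w₂.im = T' - bj := by simp [hw₂, hβjim]
      rw [this]
      calc |T' - bj| ≤ |T'| + |bj| := abs_sub _ _
        _ ≤ Λ + 1 := by rw [hT']; linarith
        _ ≤ Λ + 2 := by linarith
    have hw₂re : 1 - 2 * η ≤ w₂.re := by
      have : w₂.re = 1 + u := by simp [hw₂, hβjre]
      rw [this]; linarith
    obtain ⟨-, -, hinv₂⟩ := hzfr_of w₂ hw₂1 hw₂im hw₂re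
    rw [hM₂]
    exact mul_le_mul hnum hinv₂ (norm_nonneg _) (by positivity)
  have hΦ₂' : ∀ u : ℝ, -η ≤ u → u ≤ 1 →
      ‖Φ ((u : ℂ) + (Λ : ℂ) * I)‖ ≤ M₂ ∧ ‖Φ ((u : ℂ) + ((-Λ : ℝ) : ℂ) * I)‖ ≤ M₂ := by
    intro u hu1 hu2
    have hH0 : 0 ≤ Λ := by linarith
    exact ⟨hΦ₂ u hu1 hu2 Λ (abs_of_nonneg hH0),
      hΦ₂ u hu1 hu2 (-Λ) (by rw [abs_neg, abs_of_nonneg hH0])⟩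
  -- integrability on the line
  have hσ₀ : (1 : ℝ) + (-β).re ≠ 0 := by rw [hβre]; norm_num
  have ha' : (-η) + (-β).re ≠ 0 := by rw [hβre]; linarith
  have hint := GaussKernelContour.integrable_integrand_line (Φ := Φ) (β := -β) (Λ := Λ) (Y := x)
    hΛ0 hx0 (σ := 1) hσ₀ hΦcont hΦ₀
  -- the poles `S = {0, β₆}` and the region
  have hHβ : |(-β).im| < Λ := by
    rw [hβim']
    exact lt_of_lt_of_le (lt_trans (mul_lt_mul_of_pos_left hα1 (by norm_num)) (by norm_num)) hΛ1
  have hKU : Icc (-η) 1 ×ℂ Icc (-Λ) Λ ⊆ U := by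
    intro z hz
    rw [mem_reProdIm] at hz
    refine ⟨by linarith [hz.1.1], ?_⟩
    have := abs_le.mpr ⟨by linarith [hz.2.1], hz.2.2⟩
    linarith
  set S : Finset ℂ := {0, β} with hSdef
  have hβre0 : β.re = 0 := by rw [hβ]; simp
  have hβim0 : β.im = 3 / 2 * alpha D := by rw [hβ]; simp
  have hS : (S : Set ℂ) ⊆ Ioo (-η) 1 ×ℂ Ioo (-Λ) Λ := by
    intro p hp
    simp only [hSdef, Finset.coe_insert, Finset.coe_singleton, Set.mem_insert_iff,
      Set.mem_singleton_iff] at hp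
    rw [mem_reProdIm]
    rcases hp with rfl | rfl
    · refine ⟨⟨?_, ?_⟩, ⟨?_, ?_⟩⟩ <;> simp <;> linarith
    · refine ⟨⟨?_, ?_⟩, ⟨?_, ?_⟩⟩
      · rw [hβre0]; linarith
      · rw [hβre0]; norm_num
      · rw [hβim0]; linarith
      · rw [hβim0]; linarith
  -- differentiability of `G = Φ·K` on `U \ S`
  have hG : DifferentiableOn ℂ (fun s => Φ s * ((x : ℂ) ^ (s + -β) * omega1 Λ (s + -β) / (s + -β)))
      (U \ ↑S) := by
    intro z hz
    have hzU : z ∈ U := hz.1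
    have hzS : z ∉ S := hz.2
    rw [hSdef, Finset.mem_insert, Finset.mem_singleton, not_or] at hzS
    have h1 := hΦdiff z hzS.1 (hζ₁U z hzU)
    have h2 := GaussKernelContour.differentiableAt_kernel hx0 Λ (β := -β) (s := z)
      (by rw [← sub_eq_add_neg]; exact sub_ne_zero.mpr hzS.2)
    exact (h1.mul h2).differentiableWithinAt
  -- the two residues as punctured limits
  set R₀ : ℂ := βj / β * (omega1 Λ (-β) / riemannZeta₁ (1 - βj)) with hR₀
  set Rβ : ℂ := (x : ℂ) ^ β * riemannZeta (1 + β) * ((β - βj) / riemannZeta₁ (1 + β - βj)) with hRβ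
  have hζ₁0 : riemannZeta₁ (1 - βj) ≠ 0 := by
    have h := hζ₁U 0 ⟨by simp; linarith, by simp; linarith⟩
    simpa using h
  have hζ₁β : riemannZeta₁ (1 + β - βj) ≠ 0 := by
    refine hζ₁U β ⟨?_, ?_⟩
    · rw [hβre0]; linarith
    · rw [hβim0, abs_of_pos (by positivity)]; linarith
  have hlim0 : Tendsto (fun z => (z - 0) * (Φ z * ((x : ℂ) ^ (z + -β) * omega1 Λ (z + -β) / (z + -β))))
      (𝓝[≠] 0) (𝓝 R₀) := by
    -- `z ζ(1+z) → 1`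
    have h1 : Tendsto (fun z : ℂ => z * riemannZeta (1 + z)) (𝓝[≠] 0) (𝓝 1) := by
      have hg : Tendsto (fun z : ℂ => 1 + z) (𝓝[≠] 0) (𝓝[≠] 1) := by
        refine tendsto_nhdsWithin_iff.mpr ⟨?_, ?_⟩
        · exact ((continuous_const.add continuous_id).tendsto' 0 1 (by simp)).mono_left
            nhdsWithin_le_nhds
        · refine eventually_nhdsWithin_of_forall fun z hz => ?_
          simp only [mem_compl_iff, mem_singleton_iff] at hz ⊢
          intro h; apply hz; linear_combination h
      have h := riemannZeta_residue_one.comp hg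
      refine h.congr fun z => ?_
      simp only [Function.comp_apply]; ring
    -- the rest is continuous at `0`
    have h2 : ContinuousAt (fun z : ℂ => (x : ℂ) ^ β * ((z - βj) / riemannZeta₁ (1 + z - βj)) *
        ((x : ℂ) ^ (z + -β) * omega1 Λ (z + -β) / (z + -β))) 0 := by
      have ha : DifferentiableAt ℂ (fun z : ℂ => (z - βj) / riemannZeta₁ (1 + z - βj)) 0 := by
        have h2' : DifferentiableAt ℂ (fun z : ℂ => riemannZeta₁ (1 + z - βj)) 0 :=
          (differentiable_riemannZeta₁.differentiableAt).comp 0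
            ((differentiableAt_id.const_add (1 : ℂ)).sub_const βj)
        exact (differentiableAt_id.sub_const βj).div h2' (by simpa using hζ₁0)
      have hb := GaussKernelContour.differentiableAt_kernel hx0 Λ (β := -β) (s := 0)
        (by simpa using neg_ne_zero.mpr hβ0)
      exact (((differentiableAt_const _).mul ha).mul hb).continuousAt
    have h3 := h1.mul (h2.tendsto.mono_left nhdsWithin_le_nhds)
    have hval : (1 : ℂ) * ((x : ℂ) ^ β * ((0 - βj) / riemannZeta₁ (1 + 0 - βj)) *
        ((x : ℂ) ^ ((0 : ℂ) + -β) * omega1 Λ ((0 : ℂ) + -β) / ((0 : ℂ) + -β))) = R₀ := by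
      have hxβ0 : (x : ℂ) ^ β ≠ 0 := by
        rw [Ne, Complex.cpow_eq_zero_iff]; exact fun h => hxC h.1
      have hAB : (x : ℂ) ^ β * (x : ℂ) ^ (-β) = 1 := by
        rw [Complex.cpow_neg, mul_inv_cancel₀ hxβ0]
      rw [hR₀, zero_sub, zero_add, add_zero, one_mul]
      have : (x : ℂ) ^ β * (-βj / riemannZeta₁ (1 - βj)) *
          ((x : ℂ) ^ (-β) * omega1 Λ (-β) / -β) =
          ((x : ℂ) ^ β * (x : ℂ) ^ (-β)) * (βj * omega1 Λ (-β)) / (β * riemannZeta₁ (1 - βj)) := by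
        field_simp
      rw [this, hAB, one_mul]
      field_simp
    rw [← hval]
    refine h3.congr fun z => ?_
    simp only [hΦdef, sub_zero]; ring
  have hlimβ : Tendsto (fun z => (z - β) * (Φ z * ((x : ℂ) ^ (z + -β) * omega1 Λ (z + -β) / (z + -β))))
      (𝓝[≠] β) (𝓝 Rβ) := by
    have h2 : ContinuousAt (fun z : ℂ => Φ z * ((x : ℂ) ^ (z + -β) * omega1 Λ (z + -β))) β := by
      have ha := hΦdiff β hβ0 hζ₁β
      have hb := GaussKernelContour.differentiable_kernel_num hx0 Λ (-β) β
      exact (ha.mul hb).continuousAt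
    have hval : Φ β * ((x : ℂ) ^ (β + -β) * omega1 Λ (β + -β)) = Rβ := by
      rw [hRβ, add_neg_cancel, Complex.cpow_zero]
      simp [omega1, hΦdef]
    rw [← hval]
    refine (h2.tendsto.mono_left nhdsWithin_le_nhds).congr' ?_
    refine eventually_nhdsWithin_of_forall fun z hz => ?_
    simp only [mem_compl_iff, mem_singleton_iff] at hz
    have hzβ : z + -β ≠ 0 := by rw [← sub_eq_add_neg]; exact sub_ne_zero.mpr hz
    show Φ z * ((x : ℂ) ^ (z + -β) * omega1 Λ (z + -β)) =
      (z - β) * (Φ z * ((x : ℂ) ^ (z + -β) * omega1 Λ (z + -β) / (z + -β)))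
    rw [sub_eq_add_neg z β]
    field_simp
  have hlim : ∀ p ∈ S, ∃ r : ℂ, Tendsto (fun z => (z - p) * (Φ z *
      ((x : ℂ) ^ (z + -β) * omega1 Λ (z + -β) / (z + -β)))) (𝓝[≠] p) (𝓝 r) := by
    intro p hp
    rw [hSdef, Finset.mem_insert, Finset.mem_singleton] at hp
    rcases hp with rfl | rfl
    · exact ⟨R₀, hlim0⟩
    · exact ⟨Rβ, hlimβ⟩
  -- the engine
  have haσ : (-η : ℝ) < 1 := by linarith
  have hMz : (0 : ℝ) ≤ 4 := by norm_num
  have hmain := GaussKernelContour.norm_lineIntegral_sub_sum_limUnder_le (Φ := Φ) (β := -β)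
    hΛ0 hx0 haσ hHβ ha' hσ₀ hMz hM₁0 hM₂0 (fun t _ => hΦ₀ t) hΦ₁ hΦ₂' hint S U hUopen
    hKU hS hG hlim
  -- the residue sum
  have hsum : ∑ p ∈ S, limUnder (𝓝[≠] p) (fun z => (z - p) * (Φ z *
      ((x : ℂ) ^ (z + -β) * omega1 Λ (z + -β) / (z + -β)))) = R₀ + Rβ := by
    rw [hSdef, Finset.sum_pair hβ0.symm, hlim0.limUnder_eq, hlimβ.limUnder_eq]
  rw [hsum] at hmain
  -- unfold `Φ` in the integrand of `hmain`
  have hI : (∫ t : ℝ, Φ (((1 : ℝ) : ℂ) + t * I) *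
      ((x : ℂ) ^ ((((1 : ℝ) : ℂ) + t * I) + -β) * omega1 Λ ((((1 : ℝ) : ℂ) + t * I) + -β) /
        ((((1 : ℝ) : ℂ) + t * I) + -β))) =
      ∫ t : ℝ, ((x : ℂ) ^ β * riemannZeta (1 + (((1 : ℝ) : ℂ) + t * I)) *
          (((((1 : ℝ) : ℂ) + t * I) - βj) / riemannZeta₁ (1 + (((1 : ℝ) : ℂ) + t * I) - βj))) *
        ((x : ℂ) ^ ((((1 : ℝ) : ℂ) + t * I) + -β) * omega1 Λ ((((1 : ℝ) : ℂ) + t * I) + -β) /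
          ((((1 : ℝ) : ℂ) + t * I) + -β)) := by
    rw [hΦdef]
  rw [hI] at hmain
  refine hmain.trans ?_
  -- ## the error bound is `O(α)`
  rw [hβre, hβim']
  simp only [add_zero]
  have habs1 : |(1 : ℝ)| = 1 := abs_one
  have habsη : |(-η : ℝ)| = η := by rw [abs_neg, abs_of_pos hη0]
  rw [habs1, habsη]
  exact engine_rhs_le hL2 hΛdef hcb0 hC0 hαdef hα0 hα1 hx1 hx2 hℓH0 hℓH31 hηdef hη0 hη1 hηlow hM₁ hM₂

end Literature.NumberTheory.LFunctions.Zhang2022.AppendixBVarrho
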